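import Summits.CriticalPhenomena.SAWScalingLimit.Theorems.SAWTotalPositivityCriticalBubbleBoundJoinBigDefs
import Summits.CriticalPhenomena.SAWScalingLimit.Theorems.SAWTotalPositivityCriticalBubbleBoundJoinEntropy
import Summits.CriticalPhenomena.SAWScalingLimit.Theorems.SAWTotalPositivityCriticalBubbleBoundJoinLeftQuarter
import Summits.CriticalPhenomena.SAWScalingLimit.Theorems.SAWTotalPositivityCriticalBubbleBoundJoinMacroDoor

/-!
# The entropy knob of the join-mass ledger from the big-mass fraction
(crux `SAWTotalPositivity.CriticalBubbleBound`, stmt-CriticalPhenomena-7117; line `docking-census-joining`,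
registered stubs `joinEntropyAt_of_bigMassFraction` and
`criticalBubbleBound_of_bigMassFraction_of_joinMacroRarity` of the join-mass programme, lead prover c7)

`joinEntropyAt_of_bigMassFraction`: for `ν' > 0`, `BigMassFraction ν' → JoinEntropyAt (1 + ν')`.
Hammond's Lemma 4.11/4.12 in the class model, with the deterministic height `√N` of a tall class
(`Join.Dent_ge`, entropy `κ = 3/2`) replaced by the size hypothesis: if a fraction `c` of the critical mass
`R'_i` of the dyadic block is carried by BIG classes (linear size `max (height, width) ≥ 2^{ν' i}`), then

* big LEFT classes carry at least a quarter of the big mass (`card_filter_isBigAt_le_four_mul`, Hammond's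
  Lemma 4.9 restricted to big classes: the quarter-turn transport swaps height and width and the
  vertical flip preserves both, so both preserve `IsBigAt`);
* a big left class has height `≥ 2^{ν' i}` and its tip in the upper half, so a pair of big left classes
  has at least `min (tipRow₁ - 2) (ymax₂ + 1) ≥ 2^{ν' i} / 4` admissible offsets (`offsets_ge_big`,
  from `Join.card_offsets_ge`) once `2^{ν' i} ≥ 8`;
* hence `Dent i ≥ (2^{ν' i}/4) (Σ_n A_n)²` with `Σ_n A_n ≥ bigMass ν' i / 4 ≥ (c/4) R'_i`, i.e.
  `JoinEntropyAt (1 + ν')` with constant `c² / 64`.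

`criticalBubbleBound_of_bigMassFraction_of_joinMacroRarity`: the two-knob door — for `ν' > 0` and
`ν' + π > 1`, `BigMassFraction ν' → JoinMacroRarity π → CriticalBubbleBound`, through the parametric
macroscopic door `Join.criticalBubbleBound_of_joinEntropyAt_of_joinMacroRarity` at `κ = 1 + ν'`.
Both hypotheses are conjectures of THIS programme (proved floors `ν' = 0`, `π = 0` only); the crux item is
NOT closed by this file. [cite: Hammond2015SAPJoining, Lemma 4.9, Lemma 4.11, Lemma 4.12]
-/

noncomputable section

open Literature.Probability.LatticeModels
open Literature.Probability.RandomPlanarGeometry Literature.Probability.RandomPlanarGeometry.SAW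
open scoped BigOperators
open Summit.CriticalPhenomena.SAWScalingLimit.Theorems.CriticalBubbleBound.Negative (e₀)
open Summit.CriticalPhenomena.SAWScalingLimit.Theorems.CriticalBubbleBound.Docking

namespace Summit.CriticalPhenomena.SAWScalingLimit.Theorems.CriticalBubbleBound.Join

/-! ## Hammond's Lemma 4.9 restricted to big classes -/

/-- Counting through an injection of one filtered class into another: if `F` is injective on `L` and
maps `L.filter p` into `L.filter q`, then `#(L.filter p) ≤ #(L.filter q)`. [folklore] -/
private theorem card_filter_le_of_maps_big {L : Finset (ℕ → Site 2)} {p q : (ℕ → Site 2) → Prop}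
    [DecidablePred p] [DecidablePred q] (F : (ℕ → Site 2) → (ℕ → Site 2))
    (hinj : Set.InjOn F ↑L) (hmap : ∀ χ ∈ L, p χ → F χ ∈ L ∧ q (F χ)) :
    (L.filter p).card ≤ (L.filter q).card := by
  refine Finset.card_le_card_of_injOn F (fun χ hχ => ?_) (hinj.mono ?_)
  · rw [Finset.mem_coe, Finset.mem_filter] at hχ
    rw [Finset.mem_coe, Finset.mem_filter]
    exact hmap χ hχ.1 hχ.2
  · intro χ hχ
    exact (Finset.mem_filter.1 hχ).1

/-- The row of `ES` is at most the tip row. [folklore] -/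
private theorem esRow_le_tipRow_big (n : ℕ) (χ : ℕ → Site 2) : esRow n χ ≤ tipRow n χ := by
  obtain ⟨v, hv, hv1⟩ := exists_eq_tipRow n χ
  exact hv1 ▸ esRow_le hv

open Classical in
/-- **Hammond's Lemma 4.9 for big classes**: for `m ≥ 3`, among the lex-rooted classes of walk length `m`
that are big at exponent `ν'` and scale `i`, the left ones (tall, tip in the upper half) are at least a
quarter. The quarter-turn transport `lexRooted_transport_rot` swaps height and width and the vertical
flip `lexRooted_transport_vrefl` preserves both, so both preserve `max (height, width)`, i.e. `IsBigAt`;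
otherwise the proof is that of `card_lexRooted_le_four_mul`. [cite: Hammond2015SAPJoining, Lemma 4.9] -/
theorem card_filter_isBigAt_le_four_mul (ν' : ℝ) (i m : ℕ) (hm : 3 ≤ m) :
    ((lexRooted m).filter fun χ => IsBigAt ν' i m χ).card ≤
      4 * (((lexRooted m).filter fun χ => IsBigAt ν' i m χ).filter (IsLeftPoly m)).card := by
  set L := (lexRooted m).filter fun χ => IsBigAt ν' i m χ with hL
  have hLsub : (↑L : Set (ℕ → Site 2)) ⊆ ↑(lexRooted m) := Finset.coe_subset.2 (Finset.filter_subset _ _)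
  -- (a) at least half of the big classes are tall
  obtain ⟨F, hFinj, hF⟩ := lexRooted_transport_rot m hm
  have htall : (L.filter fun χ => ¬ IsTall m χ).card ≤ (L.filter (IsTall m)).card := by
    refine card_filter_le_of_maps_big F (hFinj.mono hLsub) fun χ hχ hnot => ?_
    rw [hL, Finset.mem_filter] at hχ
    obtain ⟨hmem, hw, hh⟩ := hF χ hχ.1
    refine ⟨?_, ?_⟩
    · rw [hL, Finset.mem_filter]
      refine ⟨hmem, ?_⟩
      have hb := hχ.2
      unfold IsBigAt at hb ⊢
      rw [hw, hh, max_comm]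
      exact hb
    · simp only [IsTall, not_le] at hnot ⊢
      rw [hw, hh]
      exact hnot.le
  have hsplit₁ : L.card = (L.filter (IsTall m)).card + (L.filter fun χ => ¬ IsTall m χ).card :=
    (Finset.card_filter_add_card_filter_not _).symm
  -- (b) at least half of the big tall classes are left
  obtain ⟨G, hGinj, hG⟩ := lexRooted_transport_vrefl m hm
  have hleft : (L.filter fun χ => IsTall m χ ∧ ¬ IsLeftPoly m χ).card ≤ (L.filter (IsLeftPoly m)).card := by
    refine card_filter_le_of_maps_big G (hGinj.mono hLsub) fun χ hχ hp => ?_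
    rw [hL, Finset.mem_filter] at hχ
    obtain ⟨hmem, hw, hh, hsum, htip⟩ := hG χ hχ.1
    obtain ⟨ht, hnl⟩ := hp
    refine ⟨?_, ?_, ?_⟩
    · rw [hL, Finset.mem_filter]
      refine ⟨hmem, ?_⟩
      have hb := hχ.2
      unfold IsBigAt at hb ⊢
      rw [hw, hh]
      exact hb
    · simp only [IsTall] at ht ⊢
      rw [hw, hh]
      exact ht
    · have hlt : 2 * tipRow m χ < ymin m χ + ymax m χ := by
        simp only [IsLeftPoly, not_and, not_le] at hnl
        exact hnl ht
      have hes := esRow_le_tipRow_big m χ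
      rw [hsum, htip]
      linarith
  have hsplit₂ : (L.filter (IsTall m)).card =
      (L.filter (IsLeftPoly m)).card + (L.filter fun χ => IsTall m χ ∧ ¬ IsLeftPoly m χ).card := by
    have h1 : (L.filter (IsTall m)).filter (IsLeftPoly m) = L.filter (IsLeftPoly m) := by
      ext χ
      simp only [Finset.mem_filter, IsLeftPoly]
      tauto
    have h2 : (L.filter (IsTall m)).filter (fun χ => ¬ IsLeftPoly m χ) =
        L.filter fun χ => IsTall m χ ∧ ¬ IsLeftPoly m χ := by
      ext χ
      simp only [Finset.mem_filter, and_assoc]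
    rw [← h1, ← h2]
    exact (Finset.card_filter_add_card_filter_not _).symm
  omega

/-! ## The geometric core: a pair of big left classes has `≥ 2^{ν' i} / 4` admissible offsets -/

/-- The offsets bound for a pair of big left classes: if `2^{ν' i} ≥ 8`, then
`2^{ν' i} / 4 ≤ #offsets`. A big left class is tall, so its height is `max (height, width) ≥ 2^{ν' i}`;
its bottom row is `0`, so `ymax = height`, and its tip lies in the upper half, `tipRow ≥ height / 2`;
then `#offsets ≥ min (tipRow₁ - 2) (ymax₂ + 1) ≥ 2^{ν' i} / 2 - 2 ≥ 2^{ν' i} / 4`.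
[cite: Hammond2015SAPJoining, Lemma 4.11] -/
theorem offsets_ge_big {ν' : ℝ} {i m₁ m₂ : ℕ} (hT : 8 ≤ (2 : ℝ) ^ (ν' * (i : ℝ)))
    {χ₁ χ₂ : ℕ → Site 2} (h₁ : χ₁ ∈ lexRooted m₁) (h₂ : χ₂ ∈ lexRooted m₂)
    (hb₁ : IsBigAt ν' i m₁ χ₁) (hb₂ : IsBigAt ν' i m₂ χ₂)
    (hl₁ : IsLeftPoly m₁ χ₁) (hl₂ : IsLeftPoly m₂ χ₂) :
    (2 : ℝ) ^ (ν' * (i : ℝ)) / 4 ≤ ((offsets m₁ m₂ χ₁ χ₂).card : ℝ) := by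
  set T : ℝ := (2 : ℝ) ^ (ν' * (i : ℝ)) with hT'
  -- for tall classes the linear size is the height
  have hmax₁ : max (height m₁ χ₁) (width m₁ χ₁) = height m₁ χ₁ := max_eq_left hl₁.1
  have hmax₂ : max (height m₂ χ₂) (width m₂ χ₂) = height m₂ χ₂ := max_eq_left hl₂.1
  have hH₁ : T ≤ ((height m₁ χ₁ : ℤ) : ℝ) := by
    have hb := hb₁
    unfold IsBigAt at hb
    rw [hmax₁] at hb
    exact hb
  have hH₂ : T ≤ ((height m₂ χ₂ : ℤ) : ℝ) := by
    have hb := hb₂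
    unfold IsBigAt at hb
    rw [hmax₂] at hb
    exact hb
  -- bottom rows are `0`; the tip of `χ₁` lies in the upper half
  have hy₁ : ymin m₁ χ₁ = 0 := ymin_eq_zero_of_mem_lexRooted h₁
  have hy₂ : ymin m₂ χ₂ = 0 := ymin_eq_zero_of_mem_lexRooted h₂
  have htip : ((height m₁ χ₁ : ℤ) : ℝ) ≤ 2 * (tipRow m₁ χ₁ : ℝ) := by
    have h := hl₁.2
    rw [hy₁, zero_add] at h
    have h' : (ymax m₁ χ₁ : ℝ) ≤ 2 * (tipRow m₁ χ₁ : ℝ) := by exact_mod_cast h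
    rw [height, hy₁, sub_zero]
    exact h'
  have hym : ((height m₂ χ₂ : ℤ) : ℝ) = (ymax m₂ χ₂ : ℝ) := by rw [height, hy₂, sub_zero]
  -- the offsets count
  have hoff := card_offsets_ge m₁ m₂ χ₁ χ₂ h₂
  have hoffR : min ((tipRow m₁ χ₁ : ℝ) - 2) ((ymax m₂ χ₂ : ℝ) + 1) ≤ ((offsets m₁ m₂ χ₁ χ₂).card : ℝ) := by
    have h' : ((min (tipRow m₁ χ₁ - 2) (ymax m₂ χ₂ + 1) : ℤ) : ℝ) ≤
        (((offsets m₁ m₂ χ₁ χ₂).card : ℤ) : ℝ) := by exact_mod_cast hoff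
    push_cast at h'
    exact h'
  refine le_trans ?_ hoffR
  rw [le_min_iff]
  constructor
  · linarith
  · rw [← hym]
    linarith

/-- The scale threshold: for `ν' > 0` there is `i₁` with `2^{ν' i} ≥ 8` for all `i ≥ i₁`. [folklore] -/
theorem exists_eight_le_two_rpow {ν' : ℝ} (hν : 0 < ν') :
    ∃ i₁ : ℕ, ∀ i : ℕ, i₁ ≤ i → (8 : ℝ) ≤ (2 : ℝ) ^ (ν' * (i : ℝ)) := by
  obtain ⟨i₁, hi₁⟩ := exists_nat_ge (3 / ν')
  refine ⟨i₁, fun i hi => ?_⟩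
  have h3 : (3 : ℝ) ≤ ν' * (i : ℝ) := by
    have h : 3 / ν' ≤ (i : ℝ) := le_trans hi₁ (by exact_mod_cast hi)
    rw [div_le_iff₀ hν] at h
    linarith
  calc (8 : ℝ) = (2 : ℝ) ^ ((3 : ℕ) : ℝ) := by rw [Real.rpow_natCast]; norm_num
    _ ≤ (2 : ℝ) ^ (ν' * (i : ℝ)) :=
        Real.rpow_le_rpow_of_exponent_le (by norm_num) (by push_cast; linarith)

/-! ## The registered stubs -/

open Classical in
/-- **The entropy knob from the big-mass fraction** (registered stub `joinEntropyAt_of_bigMassFraction`):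
for `ν' > 0`, if for all large `i` a fraction `c` of the critical mass `R'_i` of the dyadic block is
carried by classes of linear size `≥ 2^{ν' i}` (`BigMassFraction ν'`), then
`(c² / 64) · 2^{ν' i} · (R'_i)² ≤ Dent i` for all large `i`, i.e. `JoinEntropyAt (1 + ν')`: restrict
the entropy pair sum to pairs of big LEFT classes (a quarter of the big mass each, by
`card_filter_isBigAt_le_four_mul`), each pair contributing `≥ 2^{ν' i} / 4` admissible offsets
(`offsets_ge_big`). [cite: Hammond2015SAPJoining, Lemma 4.12 (arrow count)] -/
theorem joinEntropyAt_of_bigMassFraction : ∀ ν' : ℝ, 0 < ν' → BigMassFraction ν' → JoinEntropyAt (1 + ν') := by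
  intro ν' hν hfrac
  obtain ⟨c, hc, i₀, hfrac⟩ := hfrac
  obtain ⟨i₁, hi₁⟩ := exists_eight_le_two_rpow hν
  refine ⟨c ^ 2 / 64, by positivity, max i₀ (max i₁ 12), fun i hi => ?_⟩
  have hi₀ : i₀ ≤ i := le_trans (le_max_left _ _) hi
  have hi₁' : i₁ ≤ i := le_trans (le_trans (le_max_left _ _) (le_max_right _ _)) hi
  have hi12 : 12 ≤ i := le_trans (le_trans (le_max_right _ _) (le_max_right _ _)) hi
  have hexp : (1 + ν' - 1) * (i : ℝ) = ν' * (i : ℝ) := by ring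
  rw [hexp]
  set T : ℝ := (2 : ℝ) ^ (ν' * (i : ℝ)) with hT
  have hT8 : 8 ≤ T := hi₁ i hi₁'
  have hx0 : 0 ≤ criticalFugacity := criticalFugacity_pos_lt_one'.1.le
  -- the big left classes of shifted index `n`
  set BL : ℕ → Finset (ℕ → Site 2) := fun n =>
    ((lexRooted (n - joinShift)).filter fun χ => IsBigAt ν' i (n - joinShift) χ).filter
      (IsLeftPoly (n - joinShift)) with hBL
  set A : ℕ → ℝ := fun n => ((BL n).card : ℝ) * criticalFugacity ^ (n - joinShift + 1) with hA
  have hA0 : ∀ n, 0 ≤ A n := fun n => mul_nonneg (Nat.cast_nonneg _) (pow_nonneg hx0 _)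
  have hblock : ∀ n ∈ block i, 2 ^ i ≤ n := fun n hn => (Finset.mem_Ico.1 hn).1
  have h17 : ∀ n ∈ block i, joinShift ≤ n := fun n hn =>
    le_trans (by norm_num [joinShift]) (le_trans (pow_le_pow_right₀ (by norm_num) hi12) (hblock n hn))
  have h3 : ∀ n ∈ block i, 3 ≤ n - joinShift := fun n hn => by
    have := le_trans (pow_le_pow_right₀ (by norm_num : 1 ≤ 2) hi12) (hblock n hn)
    simp only [joinShift]; omega
  -- Step 1: the big term of index `n` is at most `4 A n`
  have hstep1 : ∀ n ∈ block i,
      (((lexRooted (n - joinShift)).filter fun χ => IsBigAt ν' i (n - joinShift) χ).card : ℝ) *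
        criticalFugacity ^ (n - joinShift + 1) ≤ 4 * A n := by
    intro n hn
    have h4 := card_filter_isBigAt_le_four_mul ν' i (n - joinShift) (h3 n hn)
    have h4' : (((lexRooted (n - joinShift)).filter fun χ => IsBigAt ν' i (n - joinShift) χ).card : ℝ) ≤
        4 * ((BL n).card : ℝ) := by
      rw [hBL]; exact_mod_cast h4
    calc (((lexRooted (n - joinShift)).filter fun χ => IsBigAt ν' i (n - joinShift) χ).card : ℝ) *
          criticalFugacity ^ (n - joinShift + 1)
        ≤ 4 * ((BL n).card : ℝ) * criticalFugacity ^ (n - joinShift + 1) :=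
          mul_le_mul_of_nonneg_right h4' (pow_nonneg hx0 _)
      _ = 4 * A n := by rw [hA]; ring
  -- Step 2/3: lower bound of `Dent i` by the big-left pairs with the uniform offsets bound
  have hpair : ∀ n ∈ block i, ∀ n' ∈ block i,
      T / 4 * (A n * A n') ≤
        ∑ χ₁ ∈ lexRooted (n - joinShift), ∑ χ₂ ∈ lexRooted (n' - joinShift),
          ((offsets (n - joinShift) (n' - joinShift) χ₁ χ₂).card : ℝ) *
            criticalFugacity ^ (n - joinShift + 1 + (n' - joinShift + 1)) := by
    intro n hn n' hn'
    have hsub₁ : BL n ⊆ lexRooted (n - joinShift) :=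
      (Finset.filter_subset _ _).trans (Finset.filter_subset _ _)
    have hsub₂ : BL n' ⊆ lexRooted (n' - joinShift) :=
      (Finset.filter_subset _ _).trans (Finset.filter_subset _ _)
    have hsub : ∑ χ₁ ∈ BL n, ∑ χ₂ ∈ BL n',
        ((offsets (n - joinShift) (n' - joinShift) χ₁ χ₂).card : ℝ) *
          criticalFugacity ^ (n - joinShift + 1 + (n' - joinShift + 1)) ≤
        ∑ χ₁ ∈ lexRooted (n - joinShift), ∑ χ₂ ∈ lexRooted (n' - joinShift),
          ((offsets (n - joinShift) (n' - joinShift) χ₁ χ₂).card : ℝ) *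
            criticalFugacity ^ (n - joinShift + 1 + (n' - joinShift + 1)) := by
      refine le_trans (Finset.sum_le_sum fun χ₁ _ => ?_) (Finset.sum_le_sum_of_subset_of_nonneg
        hsub₁ fun χ₁ _ _ => Finset.sum_nonneg fun χ₂ _ =>
          mul_nonneg (Nat.cast_nonneg _) (pow_nonneg hx0 _))
      exact Finset.sum_le_sum_of_subset_of_nonneg hsub₂ fun χ₂ _ _ =>
        mul_nonneg (Nat.cast_nonneg _) (pow_nonneg hx0 _)
    refine le_trans ?_ hsub
    have hlow : ∑ χ₁ ∈ BL n, ∑ χ₂ ∈ BL n',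
        T / 4 * criticalFugacity ^ (n - joinShift + 1 + (n' - joinShift + 1)) ≤
        ∑ χ₁ ∈ BL n, ∑ χ₂ ∈ BL n',
          ((offsets (n - joinShift) (n' - joinShift) χ₁ χ₂).card : ℝ) *
            criticalFugacity ^ (n - joinShift + 1 + (n' - joinShift + 1)) := by
      refine Finset.sum_le_sum fun χ₁ hχ₁ => Finset.sum_le_sum fun χ₂ hχ₂ => ?_
      rw [hBL] at hχ₁ hχ₂
      simp only [Finset.mem_filter] at hχ₁ hχ₂
      exact mul_le_mul_of_nonneg_right
        (offsets_ge_big hT8 hχ₁.1.1 hχ₂.1.1 hχ₁.1.2 hχ₂.1.2 hχ₁.2 hχ₂.2) (pow_nonneg hx0 _)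
    refine le_trans (le_of_eq ?_) hlow
    simp only [hA, Finset.sum_const, nsmul_eq_mul, pow_add]
    ring
  have hDent : T / 4 * (∑ n ∈ block i, A n) ^ 2 ≤ Dent i := by
    rw [Dent, sq, Finset.sum_mul_sum, Finset.mul_sum]
    refine Finset.sum_le_sum fun n hn => ?_
    rw [Finset.mul_sum]
    refine Finset.sum_le_sum fun n' hn' => ?_
    rw [if_pos ⟨h17 n hn, h17 n' hn'⟩]
    exact hpair n hn n' hn'
  -- Step 4: `c R' ≤ bigMass ≤ 4 Σ A`
  have hbig : bigMass ν' i ≤ 4 * ∑ n ∈ block i, A n := by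
    rw [bigMass, Finset.mul_sum]
    refine Finset.sum_le_sum fun n hn => ?_
    rw [if_pos (h17 n hn)]
    exact hstep1 n hn
  have hR : c * blockMass jterm i ≤ 4 * ∑ n ∈ block i, A n := le_trans (hfrac i hi₀) hbig
  have hR0 : 0 ≤ blockMass jterm i := blockMass_nonneg jterm_nonneg i
  have hsum0 : 0 ≤ ∑ n ∈ block i, A n := Finset.sum_nonneg fun n _ => hA0 n
  have hT0 : 0 ≤ T := by linarith
  calc c ^ 2 / 64 * T * blockMass jterm i ^ 2 = T / 4 * (c * blockMass jterm i / 4) ^ 2 := by ring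
    _ ≤ T / 4 * (∑ n ∈ block i, A n) ^ 2 := by
        apply mul_le_mul_of_nonneg_left _ (by positivity)
        apply pow_le_pow_left₀ (by positivity)
        linarith
    _ ≤ Dent i := hDent

/-- **The two-knob door** (registered stub `criticalBubbleBound_of_bigMassFraction_of_joinMacroRarity`):
for `ν' > 0` and `ν' + π > 1`, the big-mass fraction with exponent `ν'` and macroscopic join rarity with
exponent `π` imply the crux — the parametric macroscopic door
`criticalBubbleBound_of_joinEntropyAt_of_joinMacroRarity` at `κ = 1 + ν'` (`κ + π = 1 + ν' + π > 2`),
fed with `joinEntropyAt_of_bigMassFraction`. (Registered sub-goal of the crux item; both hypotheses are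
conjectures of this programme, the crux stays open.) [cite: Hammond2015SAPJoining, §4] -/
theorem criticalBubbleBound_of_bigMassFraction_of_joinMacroRarity : ∀ ν' π : ℝ, 0 < ν' → 1 < ν' + π → BigMassFraction ν' → JoinMacroRarity π → Summit.CriticalPhenomena.SAWScalingLimit.Theses.SAWTotalPositivity.CriticalBubbleBound := by
  intro ν' π hν hsum hfrac hrar
  exact criticalBubbleBound_of_joinEntropyAt_of_joinMacroRarity (1 + ν') π (by linarith) (by linarith)
    (joinEntropyAt_of_bigMassFraction ν' hν hfrac) hrar

end Summit.CriticalPhenomena.SAWScalingLimit.Theorems.CriticalBubbleBound.Join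

end
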